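import Literature.NumberTheory.ComplexMultiplication.SharedImaginaryQuadraticFamilies
import Literature.AlgebraicGeometry.Pohlmann1968.SeparatingCMFamilies
import Summits.HodgeConjecture.CorCM.PairwiseCMFamiliesHodge
import HarnessLib

/-!
# Any number of CM abelian varieties with GALOIS CM fields of degree `≡ 2 (mod 4)`: the product is stably nondegenerate
# iff all PAIRWISE `[L_i ∩ L_j : ℚ]` are odd and all factors are nondegenerate

COR-CM (cell `pub-hodgecm2`, binder seat `b23` gen 28), count-neutral; NEW as stated, hence under `Summits/`.  The
`n`-slot form of the parity theorems of `Summits/…/TwiceOddDegreeCMFieldPairsHodge` and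
`…/SharedImaginaryQuadraticCMFieldsHodge` (this seat), obtained by feeding PAIRWISE partial conjugations into seat p2's
pairwise no-common-constituent criterion (`Summits/…/PairwiseCMFamiliesHodge`, consumed BY NAME:
`isNondegenerateFamily_iff_forall_of_pairwise`, `exists_pairConj_of_conj_apply_eq`; `Literature…pairwise_of_partialConj`).
Let `(K_i)_{i∈I}` be GALOIS CM fields of degrees `2m_i` with every `m_i` ODD — CM elliptic curves (`m_i = 1`), cyclic
sextics, `ℚ(ζ_p)` for `p ≡ 3 (mod 4)`, …, mixed freely and in any number — and `L_i = normalClosure ℚ K_i ℂ`: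

* **`isNondegenerateFamily_iff_pairwise_odd`** — for ANY types:
  `IsNondegenerateFamily Φ ⟺ (∀ i ≠ j, [L_i ∩ L_j : ℚ] odd) ∧ (∀ i, Φ_i nondegenerate)`.
  `⟸`: an odd-degree Galois subfield of `ℂ` is totally real, so each pair `i ≠ j` carries a pairwise partial conjugation
  (conjugation on `Hom(K_i, ℂ)`, identity on `Hom(K_j, ℂ)`), which excludes common constituents of `U(Φ_i)`, `U(Φ_j)`;
  `⟹`: an even `[L_i ∩ L_j : ℚ]` puts an imaginary quadratic field in `L_i ∩ L_j` (Schur–Zassenhaus,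
  `GaloisCMFieldsTwiceOddDegreePair`), which makes EVERY family degenerate (`SharedImaginaryQuadraticFamilies`); members of
  nondegenerate families are nondegenerate (7.6.1).  With all `m_i = 1` this is Imai–Murty for CM elliptic curves
  (pairwise odd ⟺ pairwise distinct fields);
* **`hodgeConjectureFor_prod_of_pairwise_odd`**, `hodgeClassSpan_prod_eq_divisorClassesSpan_of_pairwise_odd` — under the
  right-hand side, the Hodge conjecture and `B• = D•` on every `⨁_{j<N} A_{π j}` (every `∏_i A_i^{k_i}`) of realisations;
* **`forall_prod_hodgeClassSpan_eq_iff_pairwise_odd`**, **`exists_exceptional_prod_iff_of_pairwise`** — for separating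
  realisations (simple, pairwise non-isogenous): `B• = D•` everywhere ⟺ the right-hand side; an exceptional Hodge class
  on some product ⟺ some pairwise degree is even or some type is degenerate;
* `hodgeConjectureFor_prod_of_isSimple_of_pairwise_odd` — simple, pairwise non-isogenous factors with nondegenerate types.

Theorems only, no definition, no `sorry`.

## References

* [Gordon1999HodgeAVSurvey] B. B. Gordon, *A survey of the Hodge conjecture for abelian varieties*, §3 Theorem (Imai,
  Murty) and proof, 7.4–7.7, 7.6.1, 9.4.3, 10.10.
* [MoonenZarhin1999LowDim] B. Moonen, Yu. Zarhin, *Hodge classes on abelian varieties of low dimension*, Cor. (3.9).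
* [Rotman1995] J. J. Rotman, *An Introduction to the Theory of Groups*, 4th ed., GTM 148, Thm. 7.41 (Schur–Zassenhaus).
* [Deligne1982HodgeCycles] P. Deligne, *Hodge cycles on abelian varieties*, LNM 900 (1982), §4.
-/

noncomputable section

open CategoryTheory CategoryTheory.Limits NumberField NumberField.ComplexEmbedding IntermediateField Module

namespace Summit.HodgeConjecture.CorCM

open Literature.NumberTheory.ComplexMultiplication
open Literature.AlgebraicGeometry.Motives (AbelianVariety CMType)
open Literature.AlgebraicGeometry.HodgeTheory
open Literature.AlgebraicGeometry.ComplexMultiplication (IsCMTypeRealisation)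
open Literature.AlgebraicGeometry.VanGeemen1994 (hodgeClassSpan)
open Literature.AlgebraicGeometry.Pohlmann1968
open Literature.Barriers.HodgeConjecture (divisorClassesSpan)

/-! ### Types -/

section Types

variable {I : Type} {K : I → Type} [∀ i, Field (K i)] [∀ i, NumberField (K i)] [∀ i, IsCMField (K i)] [Fintype I]
  [DecidableEq I] {Φ : ∀ i, CMType (K i)}

/-- A subfield of a finite extension (inside `ℂ`) is finite. [folklore] -/
private theorem finiteDimensional_of_le₇ {E E' : IntermediateField ℚ ℂ} [FiniteDimensional ℚ E] (h : E' ≤ E) :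
    FiniteDimensional ℚ E' :=
  FiniteDimensional.of_injective (IntermediateField.inclusion h).toLinearMap (IntermediateField.inclusion_injective h)

omit [DecidableEq I] in
/-- **Odd pairwise intersections give pairwise partial conjugations, hence the pairwise criterion.**  If
`[L_i ∩ L_j : ℚ]` is odd for all `i ≠ j`, the Galois field `L_i ∩ L_j ≤ ℂ` is totally real, so some `σ ∈ Aut(ℂ)` is
conjugation on `Hom(K_i, ℂ)` and the identity on `Hom(K_j, ℂ)`, and `U(Φ_i)`, `U(Φ_j)` have no common constituent.
[cite: Gordon1999HodgeAVSurvey, §3 Theorem (proof)] [cite: MoonenZarhin1999LowDim, Cor. (3.9)] -/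
theorem pairwise_of_forall_odd_finrank_inf (Φ : ∀ i, CMType (K i))
    (hodd : ∀ i j, i ≠ j → Odd (finrank ℚ ↥(normalClosure ℚ (K i) ℂ ⊓ normalClosure ℚ (K j) ℂ))) :
    ∀ i j, i ≠ j → ∀ P : Submodule ℚ ((K i →+* ℂ) → ℚ), P ≤ antiSpan (ℂ ≃+* ℂ) (Φ i).1 →
      (∀ g : ℂ ≃+* ℂ, ∀ f ∈ P, (fun x => f (g • x)) ∈ P) →
      ∀ T : ((K i →+* ℂ) → ℚ) →ₗ[ℚ] ((K j →+* ℂ) → ℚ),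
        (∀ g : ℂ ≃+* ℂ, ∀ f ∈ P, T (fun x => f (g • x)) = fun y => T f (g • y)) →
        (∀ f ∈ P, T f ∈ antiSpan (ℂ ≃+* ℂ) (Φ j).1) → (∀ f ∈ P, T f = 0 → f = 0) → P = ⊥ := by
  intro i j hij
  haveI : ∀ l : I, @Normal ℚ ↥(normalClosure ℚ (K l) ℂ) _ _ (IntermediateField.algebra' _) :=
    normal_normalClosure_complex
  letI : Algebra ℚ ↥(normalClosure ℚ (K i) ℂ ⊓ normalClosure ℚ (K j) ℂ) := IntermediateField.algebra' _
  haveI : FiniteDimensional ℚ ↥(normalClosure ℚ (K i) ℂ ⊓ normalClosure ℚ (K j) ℂ) :=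
    finiteDimensional_of_le₇ inf_le_left
  have hreal : ∀ x : ℂ, x ∈ normalClosure ℚ (K i) ℂ → x ∈ normalClosure ℚ (K j) ℂ → starRingEnd ℂ x = x :=
    fun x h₁ h₂ => conj_apply_eq_of_odd_finrank _ (hodd i j hij) ⟨h₁, h₂⟩
  obtain ⟨σ, hσ, hσ'⟩ := exists_pairConj_of_conj_apply_eq hij hreal
  exact (pairwise_of_partialConj (G := ℂ ≃+* ℂ) (Φ := fun l => (Φ l).1) (fun l => isCMTypeWith_conj (Φ l))
    (i := i) (j := j) (σ := σ) (fun s => by rw [hσ s, conj_smul_eq_conjugate]) hσ').1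

variable [Nonempty I]

/-- **The `n`-slot parity theorem.**  For Galois CM fields `K_i` of degrees `2m_i`, every `m_i` odd, and ANY types:
the family `(Φ_i)_i` is nondegenerate — `rank Hg(∏_i A_i) = Σ_i dim A_i`, no exceptional Hodge class on any
`∏_i A_i^{k_i}` — iff ALL PAIRWISE degrees `[L_i ∩ L_j : ℚ]` (`i ≠ j`) are ODD and every `Φ_i` is nondegenerate.  With
all `m_i = 1`: Imai–Murty for CM elliptic curves. [cite: Gordon1999HodgeAVSurvey, §3 Theorem, 7.5–7.7, 7.6.1 and 9.4.3]
[cite: MoonenZarhin1999LowDim, Cor. (3.9)] [cite: Rotman1995, Thm. 7.41] -/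
theorem isNondegenerateFamily_iff_pairwise_odd {m : I → ℕ} (hm : ∀ i, Odd (m i)) [∀ i, IsGalois ℚ (K i)]
    (hdeg : ∀ i, finrank ℚ (K i) = 2 * m i) :
    CMAlgebra.IsNondegenerateFamily Φ ↔
      (∀ i j, i ≠ j → Odd (finrank ℚ ↥(normalClosure ℚ (K i) ℂ ⊓ normalClosure ℚ (K j) ℂ))) ∧
        ∀ i, IsNondegenerate (Φ i) := by
  refine ⟨fun hnd => ⟨fun i j hij => ?_, fun i => hnd.isNondegenerate i⟩, fun h => ?_⟩
  · rcases Nat.even_or_odd (finrank ℚ ↥(normalClosure ℚ (K i) ℂ ⊓ normalClosure ℚ (K j) ℂ)) with hev | hodd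
    · exact absurd hnd (not_isNondegenerateFamily_of_even_finrank_inf (hm j) hij (hdeg j) hev Φ)
    · exact hodd
  · exact (isNondegenerateFamily_iff_forall_of_pairwise Φ (pairwise_of_forall_odd_finrank_inf Φ h.1)).2 h.2

/-- **Additive rank under odd pairwise intersections** (all types): `cmFamilyRank Φ + |I| = Σ_i cmTypeRank Φ_i + 1`,
i.e. `Hg(∏_i A_i) = ∏_i Hg(A_i)`. [cite: Gordon1999HodgeAVSurvey, §3 Theorem (1)] -/
theorem cmFamilyRank_add_card_eq_of_pairwise_odd (Φ : ∀ i, CMType (K i))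
    (hodd : ∀ i j, i ≠ j → Odd (finrank ℚ ↥(normalClosure ℚ (K i) ℂ ⊓ normalClosure ℚ (K j) ℂ))) :
    CMAlgebra.cmFamilyRank Φ + Fintype.card I = (∑ i, cmTypeRank (Φ i)) + 1 :=
  cmFamilyRank_add_card_eq_of_pairwise Φ (pairwise_of_forall_odd_finrank_inf Φ hodd)

end Types

/-! ### Abelian varieties -/

section Geometry

variable {I : Type} {K : I → Type} [∀ i, Field (K i)] [∀ i, NumberField (K i)] [∀ i, IsCMField (K i)] [Fintype I]
  [DecidableEq I] [Nonempty I] {Φ : ∀ i, CMType (K i)}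
variable {A : I → AbelianVariety ℂ} {ι : ∀ i, 𝓞 (K i) →+* End (A i)}
  {θ : ∀ i, K i →+* Module.End ℂ (complexBetti (A i).X 1)}

/-- **Odd pairwise intersections, nondegenerate types: the Hodge conjecture for every `∏_i A_i^{k_i}`** (every
`⨁_{j<N} A_{π j}`) of realisations — for ARBITRARY CM fields (the degree hypothesis is only needed for the converse);
UNCONDITIONAL. [cite: Gordon1999HodgeAVSurvey, §3 Theorem and 10.10] [cite: MoonenZarhin1999LowDim, Cor. (3.9)] -/
theorem hodgeConjectureFor_prod_of_pairwise_odd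
    (hodd : ∀ i j, i ≠ j → Odd (finrank ℚ ↥(normalClosure ℚ (K i) ℂ ⊓ normalClosure ℚ (K j) ℂ)))
    (hΦ : ∀ i, IsNondegenerate (Φ i)) (hA : ∀ i, IsCMTypeRealisation (Φ i) (A i) (ι i) (θ i)) {N : ℕ}
    (π : Fin N → I) :
    HodgeConjectureFor (⨁ fun j : Fin N => A (π j)).dim (⨁ fun j : Fin N => A (π j)).X :=
  ((isNondegenerateFamily_iff_forall_of_pairwise Φ (pairwise_of_forall_odd_finrank_inf Φ hodd)).2
    hΦ).hodgeConjectureFor_prod hA π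

/-- **Odd pairwise intersections, nondegenerate types: `Bᵐ ⊗ ℂ = Dᵐ ⊗ ℂ` on every `∏_i A_i^{k_i}`.**
[cite: Gordon1999HodgeAVSurvey, §3 Theorem (2) and 7.5] -/
theorem hodgeClassSpan_prod_eq_divisorClassesSpan_of_pairwise_odd
    (hodd : ∀ i j, i ≠ j → Odd (finrank ℚ ↥(normalClosure ℚ (K i) ℂ ⊓ normalClosure ℚ (K j) ℂ)))
    (hΦ : ∀ i, IsNondegenerate (Φ i)) (hA : ∀ i, IsCMTypeRealisation (Φ i) (A i) (ι i) (θ i)) {N : ℕ}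
    (π : Fin N → I) (m : ℕ) :
    hodgeClassSpan (⨁ fun j : Fin N => A (π j)).dim (⨁ fun j : Fin N => A (π j)).X m =
      divisorClassesSpan (⨁ fun j : Fin N => A (π j)).X (⨁ fun j : Fin N => A (π j)).dim m :=
  ((isNondegenerateFamily_iff_forall_of_pairwise Φ (pairwise_of_forall_odd_finrank_inf Φ hodd)).2
    hΦ).hodgeClassSpan_prod_eq_divisorClassesSpan hA π m

/-- **`B• = D•` on every `∏_i A_i^{k_i}` iff all pairwise `[L_i ∩ L_j : ℚ]` are odd and all types are nondegenerate** —
separating realisations of Galois CM fields of degrees `2m_i`, all `m_i` odd. [cite: Gordon1999HodgeAVSurvey, §3 Theorem, 7.5–7.7 and 7.6.1]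
[cite: Rotman1995, Thm. 7.41] -/
theorem forall_prod_hodgeClassSpan_eq_iff_pairwise_odd {m : I → ℕ} (hm : ∀ i, Odd (m i)) [∀ i, IsGalois ℚ (K i)]
    (hdeg : ∀ i, finrank ℚ (K i) = 2 * m i) (hsep : CMAlgebra.IsSeparatingFamily Φ)
    (hA : ∀ i, IsCMTypeRealisation (Φ i) (A i) (ι i) (θ i)) :
    (∀ (N : ℕ) (π : Fin N → I) (n : ℕ),
        hodgeClassSpan (⨁ fun j : Fin N => A (π j)).dim (⨁ fun j : Fin N => A (π j)).X n =
          divisorClassesSpan (⨁ fun j : Fin N => A (π j)).X (⨁ fun j : Fin N => A (π j)).dim n) ↔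
      (∀ i j, i ≠ j → Odd (finrank ℚ ↥(normalClosure ℚ (K i) ℂ ⊓ normalClosure ℚ (K j) ℂ))) ∧
        ∀ i, IsNondegenerate (Φ i) :=
  (CMAlgebra.isNondegenerateFamily_iff_forall_prod_hodgeClassSpan_eq hsep hA).symm.trans
    (isNondegenerateFamily_iff_pairwise_odd hm hdeg)

/-- **An exceptional Hodge class on some `∏_i A_i^{k_i}` iff some pairwise `[L_i ∩ L_j : ℚ]` is even or some type is
degenerate** — separating realisations of Galois CM fields of degrees `2m_i`, all `m_i` odd.
[cite: Gordon1999HodgeAVSurvey, 7.5–7.7, 7.6.1 and 9.4.3] [cite: Deligne1982HodgeCycles, §4] [cite: Rotman1995, Thm. 7.41] -/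
theorem exists_exceptional_prod_iff_of_pairwise {m : I → ℕ} (hm : ∀ i, Odd (m i)) [∀ i, IsGalois ℚ (K i)]
    (hdeg : ∀ i, finrank ℚ (K i) = 2 * m i) (hsep : CMAlgebra.IsSeparatingFamily Φ)
    (hA : ∀ i, IsCMTypeRealisation (Φ i) (A i) (ι i) (θ i)) :
    (∃ (N : ℕ) (π : Fin N → I) (n : ℕ) (c : complexBetti (⨁ fun j : Fin N => A (π j)).X (2 * n)),
        IsRationalClass c ∧
        IsOfHodgeType (⨁ fun j : Fin N => A (π j)).dim (⨁ fun j : Fin N => A (π j)).X (2 * n) n n c ∧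
        c ∉ divisorClassesSpan (⨁ fun j : Fin N => A (π j)).X (⨁ fun j : Fin N => A (π j)).dim n) ↔
      (∃ i j, i ≠ j ∧ Even (finrank ℚ ↥(normalClosure ℚ (K i) ℂ ⊓ normalClosure ℚ (K j) ℂ))) ∨
        ∃ i, ¬ IsNondegenerate (Φ i) := by
  constructor
  · rintro ⟨N, π, n, c, hcQ, hcH, hcD⟩
    by_contra h
    push Not at h
    have hnd : CMAlgebra.IsNondegenerateFamily Φ :=
      (isNondegenerateFamily_iff_pairwise_odd hm hdeg).2
        ⟨fun i j hij => Nat.not_even_iff_odd.1 (h.1 i j hij), h.2⟩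
    exact hnd.not_exists_exceptional_prod hA π n ⟨c, hcQ, hcH, hcD⟩
  · intro h
    refine CMAlgebra.exists_exceptional_prod_of_not_isNondegenerateFamily hsep (fun hnd => ?_) hA
    have h' := (isNondegenerateFamily_iff_pairwise_odd hm hdeg).1 hnd
    rcases h with ⟨i, j, hij, hev⟩ | ⟨i, hi⟩
    · exact (Nat.not_even_iff_odd.2 (h'.1 i j hij)) hev
    · exact hi (h'.2 i)

/-- **Simple, pairwise non-isogenous factors with nondegenerate types and odd pairwise intersections: the Hodge
conjecture for every `∏_i A_i^{k_i}`** — e.g. pairwise non-isogenous CM elliptic curves `E_1, …, E_r` times simple CM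
threefolds with cyclic sextic fields `k_b·C_b` whose imaginary quadratic fields `k_b` are pairwise distinct and differ from
the curves' fields, times `ℚ(ζ_p)`-factors of nondegenerate type (`p ≡ 3 (mod 4)`, `√−p` not among the previous
fields, distinct `p`), to any powers. [cite: Gordon1999HodgeAVSurvey, §3 Theorem, 7.4 and 10.10] [cite: MoonenZarhin1999LowDim, Cor. (3.9)] -/
theorem hodgeConjectureFor_prod_of_isSimple_of_pairwise_odd
    (hodd : ∀ i j, i ≠ j → Odd (finrank ℚ ↥(normalClosure ℚ (K i) ℂ ⊓ normalClosure ℚ (K j) ℂ)))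
    (hΦ : ∀ i, IsNondegenerate (Φ i)) (hA : ∀ i, IsCMTypeRealisation (Φ i) (A i) (ι i) (θ i))
    (hs : ∀ i, (A i).IsSimple) (hniso : ∀ i j, i ≠ j → ¬ AbelianVariety.IsIsogenous (A i) (A j)) {N : ℕ}
    (π : Fin N → I) :
    HodgeConjectureFor (⨁ fun j : Fin N => A (π j)).dim (⨁ fun j : Fin N => A (π j)).X ∧
      ∀ n : ℕ, hodgeClassSpan (⨁ fun j : Fin N => A (π j)).dim (⨁ fun j : Fin N => A (π j)).X n =
        divisorClassesSpan (⨁ fun j : Fin N => A (π j)).X (⨁ fun j : Fin N => A (π j)).dim n := by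
  have _hsep : CMAlgebra.IsSeparatingFamily Φ :=
    CMAlgebra.isSeparatingFamily_of_isSimple_of_pairwise_not_isIsogenous hA hs hniso
  exact ⟨hodgeConjectureFor_prod_of_pairwise_odd hodd hΦ hA π, fun n =>
    hodgeClassSpan_prod_eq_divisorClassesSpan_of_pairwise_odd hodd hΦ hA π n⟩

omit [DecidableEq I] in
/-- **Even pairwise intersection somewhere: an exceptional Hodge class is forced, whatever the types** (separating
realisations; `K_j` Galois of degree `2m_j`, `m_j` odd, for the offending pair's second member).
[cite: Gordon1999HodgeAVSurvey, 7.5, 7.6.1 and 9.4.3] [cite: Deligne1982HodgeCycles, §4] [cite: Rotman1995, Thm. 7.41] -/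
theorem exists_exceptional_prod_of_even_finrank_inf_pair {i j : I} (hij : i ≠ j) [IsGalois ℚ (K i)] [IsGalois ℚ (K j)]
    {mj : ℕ} (hmj : Odd mj) (hdeg : finrank ℚ (K j) = 2 * mj)
    (hev : Even (finrank ℚ ↥(normalClosure ℚ (K i) ℂ ⊓ normalClosure ℚ (K j) ℂ)))
    (hsep : CMAlgebra.IsSeparatingFamily Φ) (hA : ∀ i, IsCMTypeRealisation (Φ i) (A i) (ι i) (θ i)) :
    ∃ (N : ℕ) (π : Fin N → I) (n : ℕ) (c : complexBetti (⨁ fun j : Fin N => A (π j)).X (2 * n)),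
      IsRationalClass c ∧
      IsOfHodgeType (⨁ fun j : Fin N => A (π j)).dim (⨁ fun j : Fin N => A (π j)).X (2 * n) n n c ∧
      c ∉ divisorClassesSpan (⨁ fun j : Fin N => A (π j)).X (⨁ fun j : Fin N => A (π j)).dim n :=
  CMAlgebra.exists_exceptional_prod_of_not_isNondegenerateFamily hsep
    (not_isNondegenerateFamily_of_even_finrank_inf hmj hij hdeg hev Φ) hA

end Geometry

end Summit.HodgeConjecture.CorCM

end
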